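import Summits.QuantumFields.BalabanUV.T4Continuum.Support.NE7ApeTrivialFlatEndDischarged
import Summits.QuantumFields.BalabanUV.T4Continuum.Spine.NE3.PairLandauB8
import HarnessLib

/-!
# NE7ApeTrivialFlatEndLandauRep — (APE) AT THE TRIVIAL FLAT DATUM WITH REP♭ READ AS ROW NE3's SHARED LEAF: the ONE remaining Bałaban TYPE of the END,
# [B8] Theorem 2's output at the pair `(1, U)`, is `Spine.NE3.PairLandauB8.LandauRepB8 L N (k+1) 1 U u₀ A₀ s₁ s₂ β` — the SAME hypothesis shape row NE3
# consumes (`PairLandauGaugeB8`) — so ONE discharge of [B8] Theorem 2 on the T4 carriers serves both rows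

Cell `pub-balaban`, rung (B)+1 sub-cell t4, lineage `b2b-balaban-t4-ne7-p1`, generation 72 (CRUX PROVER NE7 #1, OWNER row NE7).  File G5 — over the co-owner's
(155) `NE7ApeTrivialFlatEndDischarged.smallField_of_trivialLetters_final` (t4-ne7-p2 gen 87: F55b with G♭ discharged by (152), the top normalisation by (154f),
the corner oscillation by (154g)) and row NE3's `Spine.NE3.PairLandauB8` (cell `pub-balaban-gaps`, seat ne3: the structure `LandauRepB8` = [B8] Thm 2's
conclusions (1.36)–(1.39) READ at `j = k` for a pair (background `W`, configuration `U_A`): unitary periodic gauge `u`, skew periodic `Z` with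
`U_A^u = W·e^{Z}`, Landau condition, `‖Z‖ ≤ s₁ξ`, covariant differences `≤ s₁ξ²`, Hölder, rough Laplacian; `ξ = L^{−k}`).
WHY.  After (155) the END at the trivial flat datum displays, besides tangent-criticality, class data and numeric lines, exactly ONE Bałaban TYPE: a gauge
`u₀` and a representative `A₀` with `U^{u₀} = e^{A₀}`, `‖A₀‖ ≤ a₀`, `‖∇A₀‖ ≤ a₁` — [B8] Theorem 2's output (IFR #108).  Row NE3 displays the SAME theorem's
output as the structure `LandauRepB8` (its route Π ∕ repair R3; the `pub-balaban-gaps` ne3 seat's `LandauCorrection*`∕`LandauProjection*`∕`NormalPartB8*` files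
work towards discharging it on the T4 carriers).  THIS FILE reads NE7's REP♭ AS that structure at the pair `(W, U_A) := (1, U)`, level `k+1`: `a₀ := s₁·(L⁻¹)^{k+1}`,
`a₁ := s₁·(L⁻¹)^{2(k+1)}` (at `W = 1` the covariant difference is the plain one, `Ad 1 = id`); the Landau∕Hölder∕Laplacian members are carried, unused.  So the
two rows' dependence on [B8] Theorem 2 is ONE named shape, and any discharge of `LandauRepB8` at flat pairs closes (APE) at the trivial datum.
WHAT ([folklore]; 0 def, 0 sorry; dimension `d + 1 ≥ 2`, `n : Type`).  **`smallField_of_landauRepB8`**: (155)'s `smallField_of_trivialLetters_final` with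
`(hu₀, hu₀P, hgauge₀, hA₀P, ha₀, ha₁)` SUPPLIED by `hrep : LandauRepB8 L N (k+1) 1 U u₀ A₀ s₁ s₂ β`; every other hypothesis and the radius verbatim
(`a₀ ↦ s₁(L⁻¹)^{k+1}`, `a₁ ↦ s₁(L⁻¹)^{2(k+1)}` in the numeric lines).
HONEST FRAMING (page 1): bookkeeping by name; `LandauRepB8 … 1 U …` is [B8] Theorem 2 TYPE — a HYPOTHESIS, NOT proved (for it the configuration must be put in
the axial gauge and satisfy (1.7)∕(1.9): (1.7) is the bootstrap radius, (1.9) follows from tangent-criticality by R1 `NE7CriticalFirstVariation`); tangent-criticality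
and the numeric lines remain displayed; ONE datum (the trivial one), not F31's `hape` on the data class; (APE) NOT proved unconditionally; NOT ONE-STEP, NOT NE7;
spine 0∕9; finite T⁴ rung (B)+1 — NOT infinite volume, NOT mass gap, NOT Clay.  Continuum YM on T⁴ ⇐ BetaPertH ∧ nine spine estimates (0/9 proved); BetaPertH
⇐ (D1) ∧ (D4) ∧ CAP+tail; G-an2-4 gates asym, D1 and NE2/3/4.
-/

set_option autoImplicit false

open scoped BigOperators Matrix.Norms.L2Operator

namespace Summit.QuantumFields.BalabanUV.T4Continuum.NE7ApeTrivialFlatEndLandauRep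

open Literature.MathematicalPhysics.QuantumFieldTheory.Balaban1983to89
open B7Prop1Explicit B7Prop2Explicit MatrixLog UnitaryModel
open T4AveragingDeficitWall (IsUnitaryCfg IsSkewDir SmallField vary curlAt dirL1)
open T4AveragingDeficitWallBoundary (IsPeriodicCfg periodBox)
open AveragingDeficitPeriodicCounting (IsPeriodicDir)
open AveragingDeficitMultiLevelPrep (cavgIter LevelSmall)
open AveragingDeficitNearIdentity (Ad_one)
open MinimalActionLevels (perWin)
open BlockAveragePushDirSplit (flat)
open BlockAverageVaryHolo (nbRad)
open BlockAverageVaryDisc (rho0)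
open B4Sect5Proof (latticeConst)
open B5Hk163Strip (kappa163)
open B5Hk163TorusHolderDecay (CdecD)
open NE3HessForm (hess dAction)
open NE3TangentCovariantTower (dirIter)
open NE3QbarIterCovLiftPrep (cruxC)
open NE3RightInverseSolveLetters (thetaLoc)
open NE3HatInvCurlLetters (curl1C)
open NE3EnergyShapes (IsUnitarySite IsPeriodicSite)
open NE3.PairLandauB8 (LandauRepB8)
open NE7ApeTrivialFlatEndDischarged (smallField_of_trivialLetters_final)

noncomputable section

variable {d : ℕ}

/-- **(APE) AT THE TRIVIAL FLAT DATUM FROM ROW NE3's `LandauRepB8` AT THE PAIR `(1, U)`**: there is `K ≥ 0` (d, L, card n only) such that for every `N ≥ 1`, `k`, every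
admissible `U` (unitary; class radius `x`; plaquette radius `δ∕M²` with `δ∕M² ≤ x`; tangent-critical; IN THE FIBRE `cavgIter L (k+1) U = 1`), every
`(u₀, A₀, s₁, s₂, β)` with `LandauRepB8 L N (k+1) 1 U u₀ A₀ s₁ s₂ β` — [B8] Theorem 2's output at the pair, row NE3's shape —, every `ω` with the corner line
`M(e^{s₁(L⁻¹)^{k+1}} − 1) + 136(d+2)(d+5)M²(δ∕M²) ≤ ω`, `300(d+1)ω ≤ 1`, `e^{a₀} − 1 + 8ω∕M ≤ 1∕4`, and currencies `α₀, α₁, α̂₁` tied to `(s₁, ω)` as in (155)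
with the six numeric lines: `SmallField U ((K(τ̂+ρ̂) + C_Rĝ + 28α̂²)·M⁻²)` — (155)'s radius verbatim. [folklore] -/
theorem smallField_of_landauRepB8 {n : Type} [Fintype n] [DecidableEq n] [Nonempty n] (hd : 1 ≤ d) {L : ℕ} (hL : 2 ≤ L) :
    ∃ K : ℝ, 0 ≤ K ∧ ∀ (N : ℕ) [NeZero N] (k : ℕ)
    {U : Site (d + 1) → Fin (d + 1) → (Matrix n n ℂ)ˣ} (hU : IsUnitaryCfg U) {x δ : ℝ} (hx : 0 ≤ x) (hs : LevelSmall (d + 1) L k x)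
    (hUx : SmallField U x) (hδ : 0 ≤ δ) (hUδ : SmallField U (δ / ((L : ℝ) ^ (k + 1)) ^ 2)) (hδx : δ / ((L : ℝ) ^ (k + 1)) ^ 2 ≤ x)
    (hcritU : ∀ φ : Site (d + 1) → Fin (d + 1) → Matrix n n ℂ, IsSkewDir φ → IsPeriodicDir φ ((L ^ (k + 1) * N : ℕ) : ℤ) →
      dirIter L (k + 1) U φ = 0 → dAction U φ (perWin (d + 1) (L ^ (k + 1) * N)) = 0)
    (hflatTopU : cavgIter L (k + 1) U = flat)
    {u₀ : Site (d + 1) → (Matrix n n ℂ)ˣ} {A₀ : Site (d + 1) → Fin (d + 1) → Matrix n n ℂ} {s₁ s₂ β : ℝ}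
    (hrep : LandauRepB8 L N (k + 1) (flat (d := d + 1) (n := n)) U u₀ A₀ s₁ s₂ β) {ω : ℝ}
    (hω' : (L : ℝ) ^ (k + 1) * (Real.exp (s₁ * ((L : ℝ)⁻¹) ^ (k + 1)) - 1)
        + 136 * ((((d + 1 : ℕ) : ℝ) + 1) * (((d + 1 : ℕ) : ℝ) + 4)) * (((L : ℝ) ^ (k + 1)) ^ 2 * (δ / ((L : ℝ) ^ (k + 1)) ^ 2)) ≤ ω)
    (hωd : 300 * ((d + 1 : ℕ) : ℝ) * ω ≤ 1) (hβ : Real.exp (s₁ * ((L : ℝ)⁻¹) ^ (k + 1)) - 1 + 8 * ω / (L : ℝ) ^ (k + 1) ≤ 1 / 4)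
    {α₀ α₁ αh1 : ℝ} (hAα' : 2 * (Real.exp (s₁ * ((L : ℝ)⁻¹) ^ (k + 1)) - 1 + 8 * ω / (L : ℝ) ^ (k + 1)) ≤ α₀)
    (hA1' : 4 / 3 * (Real.exp (s₁ * ((L : ℝ)⁻¹) ^ (k + 1)) * (s₁ * (((L : ℝ)⁻¹) ^ (k + 1)) ^ 2) + 2 * (8 * ω / (L : ℝ) ^ (k + 1)) * (Real.exp (s₁ * ((L : ℝ)⁻¹) ^ (k + 1)) - 1)
        + 165 * ω / ((L : ℝ) ^ (k + 1)) ^ 2 + (8 * ω / (L : ℝ) ^ (k + 1)) ^ 2) ≤ α₁)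
    (hα₁h : α₁ ≤ αh1 / ((L : ℝ) ^ (k + 1)) ^ 2)
    (hθ : cruxC (d + 1) L * (((L : ℝ) ^ (k + 1)) ^ 2 * x) < 1) (hθl : thetaLoc (d + 1) L * (((L : ℝ) ^ (k + 1)) ^ 2 * x) < 1)
    (hε : ((L : ℝ) ^ (k + 1)) ^ 2 * x ≤ 1)
    (hσ : 4 * (3 + 12 * ((d + 1 : ℕ) : ℝ)) ^ 2 * (L : ℝ) ^ (k + 1) * α₀ ≤ rho0 (d + 1) L ^ 2)
    (hS1 : (8 * (3 + 12 * ((d + 1 : ℕ) : ℝ)) * (2 + 2 * ((((d + 1 : ℕ) : ℝ) + 1) * L)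
        * (1 + ((1250 * ((nbRad (d + 1) L : ℝ) + L) + 8 * (((d + 1 : ℕ) : ℝ) * L) + 2 * L) * (((d + 1 : ℕ) : ℝ) * (2 * nbRad (d + 1) L + 1) ^ (d + 1)))
            / ((L : ℝ) / (L : ℝ) ^ (d + 1))))) * ((L : ℝ) ^ (k + 1) * α₀) ≤ 1)
    (hb : 256 * (((d + 1 : ℕ) : ℝ) + 1) * L * (3 + 12 * ((d + 1 : ℕ) : ℝ)) * ((L : ℝ) ^ (k + 1) * α₀) ≤ 1),
    SmallField U
      ((K * (2 * (curl1C (d + 1) L / (1 - thetaLoc (d + 1) L * (((L : ℝ) ^ (k + 1)) ^ 2 * x)))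
                * (8 * (3 + 12 * ((d + 1 : ℕ) : ℝ)) * (2 + 2 * ((((d + 1 : ℕ) : ℝ) + 1) * L)
                  * (1 + ((1250 * ((nbRad (d + 1) L : ℝ) + L) + 8 * (((d + 1 : ℕ) : ℝ) * L) + 2 * L)
                      * (((d + 1 : ℕ) : ℝ) * (2 * nbRad (d + 1) L + 1) ^ (d + 1))) / ((L : ℝ) / (L : ℝ) ^ (d + 1)))))
                * δ * ((L : ℝ) ^ (k + 1) * α₀)
              + (Fintype.card (T4AveragingDeficitWall.Plane (d + 1)) : ℝ)
                * (144 * (((L : ℝ) ^ (k + 1) * α₀) * αh1) + 5440 * ((L : ℝ) ^ (k + 1) * α₀) ^ 3 + 8 * (αh1 * αh1)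
                    + 304 * (αh1 * ((L : ℝ) ^ (k + 1) * α₀) ^ 2) + 2688 * ((L : ℝ) ^ (k + 1) * α₀) ^ 4))
          + Fintype.card n * (2 * (CdecD d * (((d : ℝ) + 1) * (2 * ((d : ℝ) + 1))
              * ((2 + 32 / (kappa163 (d + 1) / (d + 1)) ^ 2) * latticeConst (d + 1) (kappa163 (d + 1) / (d + 1) / 2)))))
            * (0 + 28 * ((3 + 12 * ((d + 1 : ℕ) : ℝ)) * ((L : ℝ) ^ (k + 1) * α₀)
                  + 4 * (3 + 12 * ((d + 1 : ℕ) : ℝ)) ^ 3 / rho0 (d + 1) L ^ 2 * ((L : ℝ) ^ (k + 1) * α₀) ^ 2) ^ 2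
                + 4 * (4 * (3 + 12 * ((d + 1 : ℕ) : ℝ)) ^ 3 / rho0 (d + 1) L ^ 2 * ((L : ℝ) ^ (k + 1) * α₀) ^ 2))
          + 28 * ((L : ℝ) ^ (k + 1) * α₀) ^ 2)
        / ((L : ℝ) ^ (k + 1)) ^ 2) := by
  obtain ⟨K, hK, h⟩ := smallField_of_trivialLetters_final (n := n) hd hL
  refine ⟨K, hK, ?_⟩
  intro N _ k U hU x δ hx hs hUx hδ hUδ hδx hcritU hflatTopU u₀ A₀ s₁ s₂ β hrep ω hω' hωd hβ α₀ α₁ αh1 hAα' hA1' hα₁h hθ hθl hε hσ hS1 hb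
  have hNL : (N * L ^ (k + 1) : ℕ) = L ^ (k + 1) * N := Nat.mul_comm _ _
  have hu₀P : ∀ (y : Site (d + 1)) (i : Fin (d + 1)), u₀ (y + (((L ^ (k + 1) * N : ℕ) : ℤ)) • e i) = u₀ y := fun y i => by
    rw [← hNL]; exact hrep.periodic y i
  have hA₀P : IsPeriodicDir A₀ ((L ^ (k + 1) * N : ℕ) : ℤ) := by rw [← hNL]; exact hrep.per
  have ha₁ : ∀ (y : Site (d + 1)) (κ τ : Fin (d + 1)), ‖A₀ (y + e τ) κ - A₀ y κ‖ ≤ s₁ * (((L : ℝ)⁻¹) ^ (k + 1)) ^ 2 := fun y κ τ => by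
    have hg := hrep.grad κ y τ
    rwa [Ad_one] at hg
  exact h N k hU hx hs hUx hδ hUδ hδx hcritU hflatTopU hrep.unitary hu₀P hrep.rep hA₀P hrep.sup ha₁ hω' hωd hβ hAα' hA1' hα₁h hθ hθl hε hσ hS1 hb

end

end Summit.QuantumFields.BalabanUV.T4Continuum.NE7ApeTrivialFlatEndLandauRep
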